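import Literature.NumberTheory.EllipticCurves.CMFormalActionTaylorYProofs
import Literature.NumberTheory.EllipticCurves.RealLatticePeriod
import HarnessLib

/-!
# The CM transformation identity on the formal group from a transformation pair in CERTIFICATE shape
# `P(℘ z) = ℘(αz)·Q(℘ z)` (Silverman AT II.1.1, de Shalit II.1.10 / II.4.9, Cox 14.9 — proofs only)

Topic `NumberTheory/EllipticCurves` (theorems only; no definition, no named fact, no instance).  Sequel of `CMFormalActionTaylorProofs`
(`x`) and `CMFormalActionTaylorYProofs` (`y`), which read the CM transformation identity on the formal group of `W/ℂ` from the analytic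
input `hR : ∀ z, αz ∉ Λ → Q(℘ z) ≠ 0 ∧ ℘(αz) = P(℘ z)/Q(℘ z)` (the output shape of `PeriodPair.exists_rationalMap_of_mul_mem`, Cox 10.14,
polynomials over `ℂ`).  Here the SAME four identities are derived from the weaker, division-free **certificate shape**

  `hT : ∀ z, z ∉ Λ → αz ∉ Λ → P.eval (℘ z) = ℘(αz) * Q.eval (℘ z)`

— VERBATIM the conclusion of the tree's `PeriodPair.eval_weierstrassP_eq_weierstrassP_mul_mul` (`LatticeTransformationIdentity`, from the
transformation identities `(H1)`, `(H2)` of a kernel-checked `CMCert` certificate, `SingularModuliCertificate` / `CMTransformationCertificates`: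
e.g. `CMCert.check7`, `d = −7`, `α = (1 + √−7)/2`, invariants `(35, −49)`, degree `2`, `P, Q ∈ ℤ[α][X]`).  No non-vanishing of `Q` is required: the core lemma only needs the identity
EVENTUALLY near the expansion point.  With `TXᵢ, TYᵢ` the translate series `∘ exp_W` at `ξ(Ω)` (`i = 0`), `ξ(αΩ)` (`i = 1`), `b = b₂/12`,
`S = TX₀ + C b`, `ỹ₀ = 2TY₀ + a₁TX₀ + a₃`, `[α]_Ê = exp_W ∘ (α·log_W)`:

* `PeriodPair.transformation_of_mulLeft` — TRANSPORT of a transformation pair along a homothety: `hT` for `cΛ` with `(P, Q)` gives `hT` for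
  `Λ` with `(P(c⁻²X), c⁻²·Q(c⁻²X))` (`℘_{cΛ}(cz) = c⁻²℘_Λ(z)`, `PeriodPair.weierstrassP_mulLeft`) — a certificate is stated for ONE lattice of
  prescribed invariants `(A, B)` (`d = −7`: `(35, −49)`), the curve's period lattice has `(c₄/12, c₆/216)` (`= (c⁴)⁻¹A, (c⁶)⁻¹B` by
  `g₂_mulLeft`, `g₃_mulLeft`);
* ★ `rescale_translateX_subst_formalExp_mul_aeval_eq_of_eventually` — the `x`-identity in the logarithmic coordinate
  `(rescale α TX₁ + C b)·Q(S) = P(S)` from `∀ᶠ v in 𝓝 0, P(℘(Ω + v)) = ℘(α(Ω + v))·Q(℘(Ω + v))` alone;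
* `rescale_translateX_subst_formalExp_mul_aeval_eq_of_transformation`, ★★ `translateX_subst_formalMulBy_add_C_mul_aeval_eq_of_transformation`
  (`(translateX(ξ(αΩ)) ∘ [α]_Ê + C b)·Q(translateX(ξ Ω) + C b) = P(translateX(ξ Ω) + C b)` in `ℂ⟦t⟧`),
  `rescale_translateY_cm_identity_of_transformation`, ★★ `translateY_cm_identity_of_transformation`
  (`α·(2Y₁ + a₁X₁ + a₃)·Q(S) + (X₁ + C b)·Q′(S)·ỹ₀ = P′(S)·ỹ₀`) — from `hT`.

So the (e)-assembler of the cell's CM bridge can feed the `d = −7` certificate directly (coefficients in `ℤ[α] ⊂ 𝒪_K`, hence the descent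
`CMFormalActionNilIdealPoints(Y)` §0 along `K ↪ ℂ`, `K ↪ K_v` applies as typed).

Cell `bsd-print-cf2`, width seat `bsd-line-cf2c-w4` g14; no summit statement is proved; BSD is not proved by any of this.

## References
* [SilvermanATAEC1994] J. H. Silverman, *Advanced Topics in the Arithmetic of Elliptic Curves* (1994), II Prop. 1.1, §II.2.
* [deShalit1987] E. de Shalit, *Iwasawa theory of elliptic curves with complex multiplication* (1987), II §1.10, §4.9.
* [Cox2013] D. A. Cox, *Primes of the form x² + ny²*, 2nd ed. (2013), Thm. 10.14, Prop. 14.9.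
* [SilvermanAEC2009] J. H. Silverman, *The Arithmetic of Elliptic Curves*, 2nd ed. (2009), IV.1, VI.3.6.
-/

noncomputable section

open PowerSeries Filter Set Literature.NumberTheory.Transcendental.AndreCriterion
open scoped Topology Nat Classical

/-- The Taylor series of `f : ℂ → ℂ` at `0` (local notation, as in `AndreCriterionAnalyticProofs`). -/
local notation3 "𝓣[" f "]" =>
  (PowerSeries.mk fun n => ((Nat.factorial n : ℂ)⁻¹ * iteratedDeriv n f 0) : PowerSeries ℂ)

namespace PeriodPair

/-! ## §0 Transport of a transformation pair along a homothety of the lattice -/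

/-- **Transport of a transformation pair along a homothety.**  If `P(℘_{cΛ} u) = ℘_{cΛ}(αu)·Q(℘_{cΛ} u)` for `u, αu ∉ cΛ`, then
`P_c(℘_Λ z) = ℘_Λ(αz)·Q_c(℘_Λ z)` for `z, αz ∉ Λ` with `P_c = P(c⁻²X)`, `Q_c = c⁻²·Q(c⁻²X)` — from `℘_{cΛ}(cz) = c⁻²℘_Λ(z)`
(`weierstrassP_mulLeft`).  (For `c² ∈ K` the coefficients stay in `K`.) [cite: SilvermanAEC2009, VI.3.6] [cite: Cox2013, Thm. 10.14] -/
theorem transformation_of_mulLeft (L : PeriodPair) {c : ℂ} (hc : c ≠ 0) {α : ℂ} {P Q : Polynomial ℂ}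
    (hT : ∀ u : ℂ, u ∉ (L.mulLeft c hc).lattice → α * u ∉ (L.mulLeft c hc).lattice →
      P.eval (℘[L.mulLeft c hc] u) = ℘[L.mulLeft c hc] (α * u) * Q.eval (℘[L.mulLeft c hc] u)) :
    ∀ z : ℂ, z ∉ L.lattice → α * z ∉ L.lattice →
      (P.comp (Polynomial.C (c ^ 2)⁻¹ * Polynomial.X)).eval (℘[L] z) =
        ℘[L] (α * z) * (Polynomial.C (c ^ 2)⁻¹ * Q.comp (Polynomial.C (c ^ 2)⁻¹ * Polynomial.X)).eval (℘[L] z) := by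
  intro z hz hαz
  have h := hT (c * z) (mul_mem_mulLeft_lattice.not.mpr hz)
    (by rw [show α * (c * z) = c * (α * z) by ring]; exact mul_mem_mulLeft_lattice.not.mpr hαz)
  rw [show α * (c * z) = c * (α * z) by ring, weierstrassP_mulLeft, weierstrassP_mulLeft] at h
  simp only [Polynomial.eval_comp, Polynomial.eval_mul, Polynomial.eval_C, Polynomial.eval_X]
  rw [h]
  ring

end PeriodPair

namespace WeierstrassCurve

open PeriodPair Literature.NumberTheory.EllipticCurves

/-- `d⁄dX (rescale a f) = C a · rescale a (d⁄dX f)` (private copy, `C a * _` form of the tree's `derivative_rescale`).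
[cite: SilvermanAEC2009, IV.1] -/
private theorem derivative_rescale_C_mul' {R : Type*} [CommRing R] (a : R) (f : PowerSeries R) :
    d⁄dX R (rescale a f) = C a * rescale a (d⁄dX R f) := by
  ext n
  rw [coeff_derivative, coeff_rescale, coeff_C_mul, coeff_rescale, coeff_derivative, pow_succ]
  ring

/-- `rescale a (C r) = C r` (private copy). [cite: SilvermanAEC2009, IV.1] -/
private theorem rescale_C'' {R : Type*} [CommRing R] (a r : R) : rescale a (C r) = C r := by
  ext n
  rw [coeff_rescale, coeff_C]
  split_ifs with h
  · subst h; simp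
  · rw [mul_zero]

variable (L : PeriodPair) (W : WeierstrassCurve ℂ)

omit L in
/-- `(f ∘ g) ∘ exp_W = f ∘ (g ∘ exp_W)` for constant-term-free `g` (private copy). [cite: SilvermanAEC2009, IV.1] -/
private theorem subst_subst_formalExp' (f g : PowerSeries ℂ) (hg : constantCoeff g = 0) :
    PowerSeries.subst W.formalExp (PowerSeries.subst g f) = PowerSeries.subst (PowerSeries.subst W.formalExp g) f :=
  subst_comp_subst_apply (HasSubst.of_constantCoeff_zero' hg) (HasSubst.of_constantCoeff_zero' W.constantCoeff_formalExp) f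

/-! ## §1 The `x`-identity from the transformation identity near the expansion point -/

/-- ★ **The CM `x`-identity in the logarithmic coordinate from the transformation identity EVENTUALLY near `Ω`**:
if `P(℘(Ω + v)) = ℘(α(Ω + v))·Q(℘(Ω + v))` for `v` near `0` (and `Ω, αΩ ∉ Λ`), then
`(rescale α (translateX(ξ(αΩ)) ∘ exp_W) + C b)·Q(translateX(ξ Ω) ∘ exp_W + C b) = P(translateX(ξ Ω) ∘ exp_W + C b)` — both sides are the
Taylor series of `v ↦ ℘(α(Ω + v))·Q(℘(Ω + v))`.  No non-vanishing of `Q` is used.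
[cite: Cox2013, Prop. 14.9] [cite: SilvermanATAEC1994, II Prop. 1.1] [cite: deShalit1987, II §4.9] -/
theorem rescale_translateX_subst_formalExp_mul_aeval_eq_of_eventually (h₂ : L.g₂ = W.c₄ / 12) (h₃ : L.g₃ = W.c₆ / 216) {α : ℂ}
    {P Q : Polynomial ℂ} {Ω : ℂ} (hΩ : Ω ∉ L.lattice) (hαΩ : α * Ω ∉ L.lattice)
    (hev : ∀ᶠ v in 𝓝 (0 : ℂ), P.eval (℘[L] (Ω + v)) = ℘[L] (α * (Ω + v)) * Q.eval (℘[L] (Ω + v))) :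
    (rescale α ((W.translateX (℘[L] (α * Ω) - W.b₂ / 12)
        ((℘'[L] (α * Ω) - W.a₁ * (℘[L] (α * Ω) - W.b₂ / 12) - W.a₃) / 2)).subst W.formalExp) + C (W.b₂ / 12)) *
      Polynomial.aeval ((W.translateX (℘[L] Ω - W.b₂ / 12) ((℘'[L] Ω - W.a₁ * (℘[L] Ω - W.b₂ / 12) - W.a₃) / 2)).subst
        W.formalExp + C (W.b₂ / 12)) Q =
      Polynomial.aeval ((W.translateX (℘[L] Ω - W.b₂ / 12) ((℘'[L] Ω - W.a₁ * (℘[L] Ω - W.b₂ / 12) - W.a₃) / 2)).subst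
        W.formalExp + C (W.b₂ / 12)) P := by
  -- the two translate series as Taylor series
  have hT := taylor_weierstrassP_add_sub_eq_translateX_subst_formalExp L W h₂ h₃ hΩ
  have hT₁ := taylor_weierstrassP_add_sub_eq_translateX_subst_formalExp L W h₂ h₃ hαΩ
  -- `𝓣[v ↦ ℘(Ω + v)] = T + C b`
  have h℘ : AnalyticAt ℂ (fun v : ℂ => ℘[L] (Ω + v)) 0 := analyticAt_weierstrassP_const_add L hΩ
  have hTb : 𝓣[fun v : ℂ => ℘[L] (Ω + v)] =
      (W.translateX (℘[L] Ω - W.b₂ / 12) ((℘'[L] Ω - W.a₁ * (℘[L] Ω - W.b₂ / 12) - W.a₃) / 2)).subst W.formalExp +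
        C (W.b₂ / 12) := by
    have e : (fun v : ℂ => ℘[L] (Ω + v)) = (fun v : ℂ => ℘[L] (Ω + v) - W.b₂ / 12) + fun _ => W.b₂ / 12 := by
      funext v; simp
    have ha : AnalyticAt ℂ (fun v : ℂ => ℘[L] (Ω + v) - W.b₂ / 12) 0 := h℘.sub analyticAt_const
    rw [e, taylor_add ha analyticAt_const, hT, taylor_const]
  -- `𝓣[v ↦ ℘(αΩ + αv) − b] = rescale α T₁`
  have hF : 𝓣[fun v : ℂ => ℘[L] (α * Ω + α * v) - W.b₂ / 12] =
      rescale α ((W.translateX (℘[L] (α * Ω) - W.b₂ / 12)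
        ((℘'[L] (α * Ω) - W.a₁ * (℘[L] (α * Ω) - W.b₂ / 12) - W.a₃) / 2)).subst W.formalExp) := by
    rw [← hT₁]
    exact taylor_comp_const_mul (fun u : ℂ => ℘[L] (α * Ω + u) - W.b₂ / 12) α
  -- the function identity near `0`: `(℘(αΩ + αv) − b + b) · Q(℘(Ω + v)) = P(℘(Ω + v))`
  have hev' : (fun v : ℂ => (℘[L] (α * Ω + α * v) - W.b₂ / 12 + W.b₂ / 12) * Q.eval (℘[L] (Ω + v))) =ᶠ[𝓝 0]
      fun v : ℂ => P.eval (℘[L] (Ω + v)) := by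
    filter_upwards [hev] with v hv
    rw [sub_add_cancel, ← mul_add]
    exact hv.symm
  -- Taylor series of both sides
  have h℘α : AnalyticAt ℂ (fun v : ℂ => ℘[L] (α * Ω + α * v)) 0 :=
    (L.analyticOnNhd_weierstrassP (α * Ω) (by simpa using hαΩ)).comp_of_eq (by fun_prop) (by simp)
  have hA : AnalyticAt ℂ (fun v : ℂ => ℘[L] (α * Ω + α * v) - W.b₂ / 12 + W.b₂ / 12) 0 :=
    (h℘α.sub analyticAt_const).add analyticAt_const
  have hTA : 𝓣[fun v : ℂ => ℘[L] (α * Ω + α * v) - W.b₂ / 12 + W.b₂ / 12] =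
      rescale α ((W.translateX (℘[L] (α * Ω) - W.b₂ / 12)
        ((℘'[L] (α * Ω) - W.a₁ * (℘[L] (α * Ω) - W.b₂ / 12) - W.a₃) / 2)).subst W.formalExp) + C (W.b₂ / 12) := by
    have e : (fun v : ℂ => ℘[L] (α * Ω + α * v) - W.b₂ / 12 + W.b₂ / 12) =
        (fun v : ℂ => ℘[L] (α * Ω + α * v) - W.b₂ / 12) + fun _ => W.b₂ / 12 := by
      funext v; simp
    have ha : AnalyticAt ℂ (fun v : ℂ => ℘[L] (α * Ω + α * v) - W.b₂ / 12) 0 := h℘α.sub analyticAt_const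
    rw [e, taylor_add ha analyticAt_const, hF, taylor_const]
  have key := taylor_congr hev'
  rw [show (fun v : ℂ => (℘[L] (α * Ω + α * v) - W.b₂ / 12 + W.b₂ / 12) * Q.eval (℘[L] (Ω + v))) =
      (fun v : ℂ => ℘[L] (α * Ω + α * v) - W.b₂ / 12 + W.b₂ / 12) * fun v : ℂ => Q.eval (℘[L] (Ω + v)) from rfl,
    taylor_mul hA (analyticAt_eval_comp h℘ Q), hTA, taylor_eval_comp h℘ Q, taylor_eval_comp h℘ P, hTb] at key
  exact key

/-- **The CM `x`-identity in the logarithmic coordinate from a transformation pair in certificate shape**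
`hT : P(℘ z) = ℘(αz)·Q(℘ z)` (`z, αz ∉ Λ`) — the output of `PeriodPair.eval_weierstrassP_eq_weierstrassP_mul_mul`.
[cite: Cox2013, Prop. 14.9] [cite: SilvermanATAEC1994, II Prop. 1.1] [cite: deShalit1987, II §4.9] -/
theorem rescale_translateX_subst_formalExp_mul_aeval_eq_of_transformation (h₂ : L.g₂ = W.c₄ / 12) (h₃ : L.g₃ = W.c₆ / 216) {α : ℂ}
    {P Q : Polynomial ℂ}
    (hT : ∀ z : ℂ, z ∉ L.lattice → α * z ∉ L.lattice → P.eval (℘[L] z) = ℘[L] (α * z) * Q.eval (℘[L] z))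
    {Ω : ℂ} (hΩ : Ω ∉ L.lattice) (hαΩ : α * Ω ∉ L.lattice) :
    (rescale α ((W.translateX (℘[L] (α * Ω) - W.b₂ / 12)
        ((℘'[L] (α * Ω) - W.a₁ * (℘[L] (α * Ω) - W.b₂ / 12) - W.a₃) / 2)).subst W.formalExp) + C (W.b₂ / 12)) *
      Polynomial.aeval ((W.translateX (℘[L] Ω - W.b₂ / 12) ((℘'[L] Ω - W.a₁ * (℘[L] Ω - W.b₂ / 12) - W.a₃) / 2)).subst
        W.formalExp + C (W.b₂ / 12)) Q =
      Polynomial.aeval ((W.translateX (℘[L] Ω - W.b₂ / 12) ((℘'[L] Ω - W.a₁ * (℘[L] Ω - W.b₂ / 12) - W.a₃) / 2)).subst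
        W.formalExp + C (W.b₂ / 12)) P := by
  refine rescale_translateX_subst_formalExp_mul_aeval_eq_of_eventually L W h₂ h₃ hΩ hαΩ ?_
  have h₁ : ∀ᶠ v in 𝓝 (0 : ℂ), (1 : ℂ) * (Ω + v) ∉ L.lattice :=
    eventually_mul_add_notMem_lattice L (α := 1) (Ω := Ω) (by rwa [one_mul])
  filter_upwards [h₁, eventually_mul_add_notMem_lattice L hαΩ] with v hv hαv
  rw [one_mul] at hv
  exact hT (Ω + v) hv hαv

/-! ## §2 The `x`-identity in the formal-group coordinate -/

/-- ★★ **The CM `x`-identity in the formal-group coordinate from a transformation pair in certificate shape**: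
`((translateX(ξ(αΩ))) ∘ [α]_Ê + C b)·Q(translateX(ξ Ω) + C b) = P(translateX(ξ Ω) + C b)` in `ℂ⟦t⟧`, `[α]_Ê = exp_W ∘ (α·log_W)` —
`x(ξ(αΩ) ⊕ P([α]_Ê t))·Q(x(ξ Ω ⊕ P t) + b) = P(x(ξ Ω ⊕ P t) + b)`.
[cite: deShalit1987, II §1.10, §4.9] [cite: SilvermanATAEC1994, II Prop. 1.1] [cite: Cox2013, Prop. 14.9] -/
theorem translateX_subst_formalMulBy_add_C_mul_aeval_eq_of_transformation (h₂ : L.g₂ = W.c₄ / 12) (h₃ : L.g₃ = W.c₆ / 216) {α : ℂ}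
    {P Q : Polynomial ℂ}
    (hT : ∀ z : ℂ, z ∉ L.lattice → α * z ∉ L.lattice → P.eval (℘[L] z) = ℘[L] (α * z) * Q.eval (℘[L] z))
    {Ω : ℂ} (hΩ : Ω ∉ L.lattice) (hαΩ : α * Ω ∉ L.lattice) :
    ((W.translateX (℘[L] (α * Ω) - W.b₂ / 12) ((℘'[L] (α * Ω) - W.a₁ * (℘[L] (α * Ω) - W.b₂ / 12) - W.a₃) / 2)).subst
        (PowerSeries.subst (C α * W.formalLog) W.formalExp) + C (W.b₂ / 12)) *
      Polynomial.aeval (W.translateX (℘[L] Ω - W.b₂ / 12) ((℘'[L] Ω - W.a₁ * (℘[L] Ω - W.b₂ / 12) - W.a₃) / 2) + C (W.b₂ / 12)) Q =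
      Polynomial.aeval (W.translateX (℘[L] Ω - W.b₂ / 12) ((℘'[L] Ω - W.a₁ * (℘[L] Ω - W.b₂ / 12) - W.a₃) / 2) + C (W.b₂ / 12)) P := by
  have hexp : HasSubst W.formalExp := HasSubst.of_constantCoeff_zero' W.constantCoeff_formalExp
  have hmul0 : constantCoeff (W.formalExp.subst (C α * W.formalLog)) = 0 :=
    constantCoeff_subst_eq_zero (a := C α * W.formalLog) (by
      change PowerSeries.constantCoeff (C α * W.formalLog) = 0
      rw [map_mul, W.constantCoeff_formalLog, mul_zero]) _ W.constantCoeff_formalExp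
  apply subst_formalExp_injective W
  have key := rescale_translateX_subst_formalExp_mul_aeval_eq_of_transformation L W h₂ h₃ hT hΩ hαΩ
  rw [← coe_substAlgHom hexp, map_mul, map_add, substAlgHom_C, ← Polynomial.aeval_algHom_apply,
    ← Polynomial.aeval_algHom_apply, map_add, substAlgHom_C, coe_substAlgHom,
    subst_subst_formalExp' W _ _ hmul0, ← rescale_formalExp_eq_subst W α]
  rw [rescale_eq_subst]
  rw [rescale_eq_subst, subst_comp_subst_apply hexp (HasSubst.smul_X' α)] at key
  exact key

/-! ## §3 The `y`-identities -/

/-- **The CM `y`-identity in the logarithmic coordinate from a transformation pair in certificate shape** (derivative of §1):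
`α·(2·rescale α TY₁ + a₁·rescale α TX₁ + a₃)·Q(S) + (rescale α TX₁ + C b)·Q′(S)·ỹ₀ = P′(S)·ỹ₀`.
[cite: SilvermanATAEC1994, II Prop. 1.1] [cite: Cox2013, Prop. 14.9] [cite: deShalit1987, II §1.10, §4.9] -/
theorem rescale_translateY_cm_identity_of_transformation [W.IsElliptic] (h₂ : L.g₂ = W.c₄ / 12) (h₃ : L.g₃ = W.c₆ / 216) {α : ℂ}
    {P Q : Polynomial ℂ}
    (hT : ∀ z : ℂ, z ∉ L.lattice → α * z ∉ L.lattice → P.eval (℘[L] z) = ℘[L] (α * z) * Q.eval (℘[L] z))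
    {Ω : ℂ} (hΩ : Ω ∉ L.lattice) (hαΩ : α * Ω ∉ L.lattice) (hΩ' : ℘'[L] Ω ≠ 0) (hαΩ' : ℘'[L] (α * Ω) ≠ 0) :
    C α * (2 * rescale α ((W.translateY (℘[L] (α * Ω) - W.b₂ / 12)
            ((℘'[L] (α * Ω) - W.a₁ * (℘[L] (α * Ω) - W.b₂ / 12) - W.a₃) / 2)).subst W.formalExp) +
          C W.a₁ * rescale α ((W.translateX (℘[L] (α * Ω) - W.b₂ / 12)
            ((℘'[L] (α * Ω) - W.a₁ * (℘[L] (α * Ω) - W.b₂ / 12) - W.a₃) / 2)).subst W.formalExp) + C W.a₃) *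
        Polynomial.aeval ((W.translateX (℘[L] Ω - W.b₂ / 12) ((℘'[L] Ω - W.a₁ * (℘[L] Ω - W.b₂ / 12) - W.a₃) / 2)).subst
          W.formalExp + C (W.b₂ / 12)) Q +
      (rescale α ((W.translateX (℘[L] (α * Ω) - W.b₂ / 12)
            ((℘'[L] (α * Ω) - W.a₁ * (℘[L] (α * Ω) - W.b₂ / 12) - W.a₃) / 2)).subst W.formalExp) + C (W.b₂ / 12)) *
        Polynomial.aeval ((W.translateX (℘[L] Ω - W.b₂ / 12) ((℘'[L] Ω - W.a₁ * (℘[L] Ω - W.b₂ / 12) - W.a₃) / 2)).subst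
          W.formalExp + C (W.b₂ / 12)) (Polynomial.derivative Q) *
        (2 * (W.translateY (℘[L] Ω - W.b₂ / 12) ((℘'[L] Ω - W.a₁ * (℘[L] Ω - W.b₂ / 12) - W.a₃) / 2)).subst W.formalExp +
          C W.a₁ * (W.translateX (℘[L] Ω - W.b₂ / 12) ((℘'[L] Ω - W.a₁ * (℘[L] Ω - W.b₂ / 12) - W.a₃) / 2)).subst W.formalExp +
          C W.a₃) =
      Polynomial.aeval ((W.translateX (℘[L] Ω - W.b₂ / 12) ((℘'[L] Ω - W.a₁ * (℘[L] Ω - W.b₂ / 12) - W.a₃) / 2)).subst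
          W.formalExp + C (W.b₂ / 12)) (Polynomial.derivative P) *
        (2 * (W.translateY (℘[L] Ω - W.b₂ / 12) ((℘'[L] Ω - W.a₁ * (℘[L] Ω - W.b₂ / 12) - W.a₃) / 2)).subst W.formalExp +
          C W.a₁ * (W.translateX (℘[L] Ω - W.b₂ / 12) ((℘'[L] Ω - W.a₁ * (℘[L] Ω - W.b₂ / 12) - W.a₃) / 2)).subst W.formalExp +
          C W.a₃) := by
  have hA := rescale_translateX_subst_formalExp_mul_aeval_eq_of_transformation L W h₂ h₃ hT hΩ hαΩ
  have hD₀ := derivative_translateX_subst_formalExp L W h₂ h₃ hΩ hΩ'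
  have hD₁ := derivative_translateX_subst_formalExp L W h₂ h₃ hαΩ hαΩ'
  set TX₀ := (W.translateX (℘[L] Ω - W.b₂ / 12) ((℘'[L] Ω - W.a₁ * (℘[L] Ω - W.b₂ / 12) - W.a₃) / 2)).subst W.formalExp
  set TY₀ := (W.translateY (℘[L] Ω - W.b₂ / 12) ((℘'[L] Ω - W.a₁ * (℘[L] Ω - W.b₂ / 12) - W.a₃) / 2)).subst W.formalExp
  set TX₁ := (W.translateX (℘[L] (α * Ω) - W.b₂ / 12) ((℘'[L] (α * Ω) - W.a₁ * (℘[L] (α * Ω) - W.b₂ / 12) - W.a₃) / 2)).subst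
    W.formalExp
  set TY₁ := (W.translateY (℘[L] (α * Ω) - W.b₂ / 12) ((℘'[L] (α * Ω) - W.a₁ * (℘[L] (α * Ω) - W.b₂ / 12) - W.a₃) / 2)).subst
    W.formalExp
  set S := TX₀ + C (W.b₂ / 12) with hS
  have hd := congrArg (d⁄dX ℂ) hA
  have hdS : d⁄dX ℂ S = 2 * TY₀ + C W.a₁ * TX₀ + C W.a₃ := by rw [hS, map_add, derivative_C, add_zero, hD₀]
  have hd1 : d⁄dX ℂ (rescale α TX₁ + C (W.b₂ / 12)) = C α * (2 * rescale α TY₁ + C W.a₁ * rescale α TX₁ + C W.a₃) := by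
    rw [map_add, derivative_C, add_zero, derivative_rescale_C_mul', hD₁, map_add, map_add, map_mul, map_mul, rescale_C'', rescale_C'',
      map_ofNat]
  rw [(d⁄dX ℂ).leibniz, Derivation.map_aeval, Derivation.map_aeval, hdS, hd1, smul_eq_mul, smul_eq_mul, smul_eq_mul,
    smul_eq_mul] at hd
  linear_combination hd

/-- ★★ **The CM `y`-identity in the formal-group coordinate from a transformation pair in certificate shape**:
`α·(2Y₁ + a₁X₁ + a₃)·Q(S) + (X₁ + C b)·Q′(S)·ỹ₀ = P′(S)·ỹ₀` in `ℂ⟦t⟧`, `X₁ = translateX(ξ(αΩ)) ∘ [α]_Ê`, `Y₁ = translateY(ξ(αΩ)) ∘ [α]_Ê`,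
`S = translateX(ξ Ω) + C b`, `ỹ₀ = 2·translateY(ξ Ω) + a₁·translateX(ξ Ω) + a₃` — the `y`-chart `(P′Q − PQ′)·ỹ/(αQ²)` of the algebraic `[α]`
is computed by the formal `[α]_Ê` on `P₁ ⊕ E₁`. [cite: SilvermanATAEC1994, II Prop. 1.1] [cite: deShalit1987, II §1.10, §4.9] [cite: Cox2013, Prop. 14.9] -/
theorem translateY_cm_identity_of_transformation [W.IsElliptic] (h₂ : L.g₂ = W.c₄ / 12) (h₃ : L.g₃ = W.c₆ / 216) {α : ℂ} {P Q : Polynomial ℂ}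
    (hT : ∀ z : ℂ, z ∉ L.lattice → α * z ∉ L.lattice → P.eval (℘[L] z) = ℘[L] (α * z) * Q.eval (℘[L] z))
    {Ω : ℂ} (hΩ : Ω ∉ L.lattice) (hαΩ : α * Ω ∉ L.lattice) (hΩ' : ℘'[L] Ω ≠ 0) (hαΩ' : ℘'[L] (α * Ω) ≠ 0) :
    C α * (2 * PowerSeries.subst (PowerSeries.subst (C α * W.formalLog) W.formalExp)
            (W.translateY (℘[L] (α * Ω) - W.b₂ / 12) ((℘'[L] (α * Ω) - W.a₁ * (℘[L] (α * Ω) - W.b₂ / 12) - W.a₃) / 2)) +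
          C W.a₁ * PowerSeries.subst (PowerSeries.subst (C α * W.formalLog) W.formalExp)
            (W.translateX (℘[L] (α * Ω) - W.b₂ / 12) ((℘'[L] (α * Ω) - W.a₁ * (℘[L] (α * Ω) - W.b₂ / 12) - W.a₃) / 2)) + C W.a₃) *
        Polynomial.aeval (W.translateX (℘[L] Ω - W.b₂ / 12) ((℘'[L] Ω - W.a₁ * (℘[L] Ω - W.b₂ / 12) - W.a₃) / 2) + C (W.b₂ / 12)) Q +
      (PowerSeries.subst (PowerSeries.subst (C α * W.formalLog) W.formalExp)
            (W.translateX (℘[L] (α * Ω) - W.b₂ / 12) ((℘'[L] (α * Ω) - W.a₁ * (℘[L] (α * Ω) - W.b₂ / 12) - W.a₃) / 2)) +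
          C (W.b₂ / 12)) *
        Polynomial.aeval (W.translateX (℘[L] Ω - W.b₂ / 12) ((℘'[L] Ω - W.a₁ * (℘[L] Ω - W.b₂ / 12) - W.a₃) / 2) + C (W.b₂ / 12))
          (Polynomial.derivative Q) *
        (2 * W.translateY (℘[L] Ω - W.b₂ / 12) ((℘'[L] Ω - W.a₁ * (℘[L] Ω - W.b₂ / 12) - W.a₃) / 2) +
          C W.a₁ * W.translateX (℘[L] Ω - W.b₂ / 12) ((℘'[L] Ω - W.a₁ * (℘[L] Ω - W.b₂ / 12) - W.a₃) / 2) + C W.a₃) =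
      Polynomial.aeval (W.translateX (℘[L] Ω - W.b₂ / 12) ((℘'[L] Ω - W.a₁ * (℘[L] Ω - W.b₂ / 12) - W.a₃) / 2) + C (W.b₂ / 12))
          (Polynomial.derivative P) *
        (2 * W.translateY (℘[L] Ω - W.b₂ / 12) ((℘'[L] Ω - W.a₁ * (℘[L] Ω - W.b₂ / 12) - W.a₃) / 2) +
          C W.a₁ * W.translateX (℘[L] Ω - W.b₂ / 12) ((℘'[L] Ω - W.a₁ * (℘[L] Ω - W.b₂ / 12) - W.a₃) / 2) + C W.a₃) := by
  have hexp : HasSubst W.formalExp := HasSubst.of_constantCoeff_zero' W.constantCoeff_formalExp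
  have hlog := rescale_translateY_cm_identity_of_transformation L W h₂ h₃ hT hΩ hαΩ hΩ' hαΩ'
  apply subst_formalExp_injective W
  rw [← coe_substAlgHom hexp]
  simp only [map_mul, map_add, map_ofNat, Literature.NumberTheory.EllipticCurves.substAlgHom_C, ← Polynomial.aeval_algHom_apply]
  simp only [coe_substAlgHom hexp, subst_formalMulBy_subst_formalExp_eq_rescale]
  exact hlog

end WeierstrassCurve

end
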